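import Mathlib
import HarnessLib
import Summits.HubbardSuperconductivity.HubbardSuperconductivity.Theorems.WeakCouplingBCSWcbcsKohnLuttingerB1gFormAWindowD005D030
import Summits.HubbardSuperconductivity.HubbardSuperconductivity.Theorems.WeakCouplingBCSKlCertB1gWindowD005D035
import Summits.HubbardSuperconductivity.HubbardSuperconductivity.Theorems.KLProgrammeMuOfDopingWindowFillingD035Upper

/-!
# Route `WeakCouplingBCS` — support item `WcbcsKohnLuttingerB1g` (stmt-HubbardSuperconductivity-0158):
# the R2d certificate half in FORM (A) on the doping windows `δ ∈ [0.05, 0.35]` and `δ ∈ [0.10, 0.35]` (the leaf's FULL window)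

The STRETCH records `klCertB1gWin{U1,U2,U3,V,W}` (cell `gate-hubbard-kl`, seats hubbard-kl-cert-2 g4 / hubbard-kl-cert-3 g4–g5,
STRETCH-D035 form (i); 102 boxes on `μ ∈ [-0.8925, -0.7275]`, margins `10371, 15273, 20511, 14881, 18675 / 2²⁰`) extend the certified
chemical-potential window of the `B1g` Kohn–Luttinger certificate from `μ ∈ [-0.7275, -0.075]` (seven records, 148 boxes) to
`μ ∈ [-0.8925, -0.075]` (twelve records, 250 boxes; μ-level glue `klb1g_window_d005_d035`,
`Theorems/WeakCouplingBCSKlCertB1gWindowD005D035.lean`).  This file reads the twelve (resp. eleven, without `WinD`) records — in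
form (A), i.e. modulo the named enclosure hypotheses `klCertB1gWin_.EnclosuresB1g` — in the DOPING variable:
* `muOfDoping_mem_window_d005_d035` / `_d010_d035` — UNCONDITIONALLY `μ(δ) ∈ [-0.8925, -0.075]` for `δ ∈ [0.05, 0.35]` and
  `μ(δ) ∈ [-0.8925, -0.1775]` for `δ ∈ [0.10, 0.35]` (certified fillings `n(-0.8925) < 13/20` = `muWinD035_filling_lt`,
  `n(-0.075) ≥ 19/20` = `klfillL005_filling_ge`, `n(-0.1775) ≥ 9/10` = `klfillL010_filling_ge`; `chemicalPotentialOfDensity_window`);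
* `klCertB1gWin__b1g_le` for the five stretch records (`decide +kernel`: every box has `B1g` Ritz `rhohi ≤ -1/26`; the weakest is
  `-0.0396` at the `δ ≈ 0.35` end) and `klb1g_formA_b1g_le_window_d030_d035` (`channelInf ε₀ μ 1 B1g ≤ -1/26` on `[-0.8925, -0.7275]`);
* `klb1g_window_d005_d035_const` / `_d010_d035_const` — μ-level selection with the NUMERIC margin `10371/1048576` (the smallest
  of the twelve record margins, `klb1g_window_d005_d035_gamma_eq`; the second on `[-0.8925, -0.1775]`, eleven records);
* `klb1g_formA_r2d_certificate_d005_d035` (twelve records) / `_d010_d035` (eleven): for every `δ` of the window, (i) SELECTION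
  `channelInf ε₀ μ(δ) U B1g + (10371/1048576) U² ≤ channelInf ε₀ μ(δ) U χ` for `0 < U < 1`, `χ ≠ B1g`; (ii) ATTRACTION
  `channelInf ε₀ μ(δ) U B1g ≤ -(1/26) U²` for every `U`; `klCoefficient` corollaries (`≥ 1/26`).  Sharper constants on the
  sub-windows stand (`…FormAWindow.lean`, `…D010D025`, `…D005D025`, `…D005D030`).
Folklore glue; no definitions.  Numerics: HOME/hubbard-kl-cert-2/MU-WINDOW-4.md, HOME/hubbard-kl-cert-3/STRETCH-TABLE-g5.md.
-/

noncomputable section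

-- the tree's namespace `Summit.<Summit>.<Problem>.Theorems` repeats the summit name by design (D-0017)
set_option linter.dupNamespace false

namespace Summit.HubbardSuperconductivity.HubbardSuperconductivity.Theorems

open MeasureTheory Literature.MathematicalPhysics.QuantumLattice CwKLChiralWindow
open Summit.HubbardSuperconductivity.HubbardSuperconductivity.Theses.WeakCouplingBCS

/-! ### The doping windows sit inside the certified chemical-potential windows (unconditional) -/

/-- **`μ(δ) ∈ [-0.8925, -0.075]` for every hole doping `δ ∈ [0.05, 0.35]`** (unconditional): the certified fillings
`n(-0.8925) < 13/20` and `n(-0.075) ≥ 19/20` put `[0.05, 0.35]` inside `[1 - n(-0.075), 1 - n(-0.8925)]`, where `δ ↦ μ(δ)`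
inverts the strictly increasing filling (`chemicalPotentialOfDensity_window`). [folklore] -/
theorem muOfDoping_mem_window_d005_d035 :
    ∀ δ ∈ Set.Icc (0.05 : ℝ) 0.35,
      chemicalPotentialOfDensity (squareDispersion 1 0) (1 - δ) ∈ Set.Icc (-0.8925 : ℝ) (-0.075) := by
  obtain ⟨-, -, -, H⟩ := chemicalPotentialOfDensity_window (μ₁ := (-0.075 : ℝ)) (μ₂ := (-0.8925 : ℝ))
    (by norm_num) (by norm_num) (by norm_num)
  have hlo := klfillL005_filling_ge
  have hhi := muWinD035_filling_lt
  rw [show (-(3 / 40) : ℝ) = -0.075 by norm_num] at hlo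
  rw [show (-(357 : ℝ) / 400) = -0.8925 by norm_num] at hhi
  intro δ hδ
  refine H δ ⟨?_, ?_⟩
  · norm_num at hδ hlo ⊢; linarith [hδ.1]
  · norm_num at hδ hhi ⊢; linarith [hδ.2]

/-- **`μ(δ) ∈ [-0.8925, -0.1775]` for every hole doping `δ ∈ [0.10, 0.35]`** (unconditional; certified fillings
`n(-0.8925) < 13/20`, `n(-0.1775) ≥ 9/10`, `chemicalPotentialOfDensity_window`). [folklore] -/
theorem muOfDoping_mem_window_d010_d035 :
    ∀ δ ∈ Set.Icc (0.10 : ℝ) 0.35,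
      chemicalPotentialOfDensity (squareDispersion 1 0) (1 - δ) ∈ Set.Icc (-0.8925 : ℝ) (-0.1775) := by
  obtain ⟨-, -, -, H⟩ := chemicalPotentialOfDensity_window (μ₁ := (-0.1775 : ℝ)) (μ₂ := (-0.8925 : ℝ))
    (by norm_num) (by norm_num) (by norm_num)
  have hlo := klfillL010_filling_ge
  have hhi := muWinD035_filling_lt
  rw [show (-(71 / 400) : ℝ) = -0.1775 by norm_num] at hlo
  rw [show (-(357 : ℝ) / 400) = -0.8925 by norm_num] at hhi
  intro δ hδ
  refine H δ ⟨?_, ?_⟩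
  · norm_num at hδ hlo ⊢; linarith [hδ.1]
  · norm_num at hδ hhi ⊢; linarith [hδ.2]

/-! ### Certified attraction on the stretch records -/

/-- Every box of `klCertB1gWinU1` has `B1g` Ritz upper bound `rhohi ≤ -1/26` (kernel decision; max `-0.0396`). [folklore] -/
theorem klCertB1gWinU1_b1g_le : (klCertB1gWinU1.boxes.all fun bx => decide (bx.bB1g.rhohi ≤ -(1 / 26))) = true := by
  decide +kernel

/-- Every box of `klCertB1gWinU2` has `B1g` Ritz upper bound `rhohi ≤ -1/26` (kernel decision; max `-0.0449`). [folklore] -/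
theorem klCertB1gWinU2_b1g_le : (klCertB1gWinU2.boxes.all fun bx => decide (bx.bB1g.rhohi ≤ -(1 / 26))) = true := by
  decide +kernel

/-- Every box of `klCertB1gWinU3` has `B1g` Ritz upper bound `rhohi ≤ -1/26` (kernel decision; max `-0.0505`). [folklore] -/
theorem klCertB1gWinU3_b1g_le : (klCertB1gWinU3.boxes.all fun bx => decide (bx.bB1g.rhohi ≤ -(1 / 26))) = true := by
  decide +kernel

/-- Every box of `klCertB1gWinV` has `B1g` Ritz upper bound `rhohi ≤ -1/26` (kernel decision; max `-0.0499`). [folklore] -/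
theorem klCertB1gWinV_b1g_le : (klCertB1gWinV.boxes.all fun bx => decide (bx.bB1g.rhohi ≤ -(1 / 26))) = true := by
  decide +kernel

/-- Every box of `klCertB1gWinW` has `B1g` Ritz upper bound `rhohi ≤ -1/26` (kernel decision; max `-0.0585`). [folklore] -/
theorem klCertB1gWinW_b1g_le : (klCertB1gWinW.boxes.all fun bx => decide (bx.bB1g.rhohi ≤ -(1 / 26))) = true := by
  decide +kernel

/-- **Certified attraction on `μ ∈ [-0.8925, -0.7275]`** (the stretch window, `δ ≈ 0.30–0.35`), modulo the stretch records'
enclosures: `channelInf ε₀ μ 1 B1g ≤ -1/26`. [cite: RaghuKivelsonScalapino2010, §III Fig. 2] -/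
theorem klb1g_formA_b1g_le_window_d030_d035 (hU1 : klCertB1gWinU1.EnclosuresB1g) (hU2 : klCertB1gWinU2.EnclosuresB1g)
    (hU3 : klCertB1gWinU3.EnclosuresB1g) (hV : klCertB1gWinV.EnclosuresB1g) (hW : klCertB1gWinW.EnclosuresB1g) :
    ∀ μ ∈ Set.Icc (-0.8925 : ℝ) (-0.7275), channelInf (squareDispersion 1 0) μ 1 D4Irrep.B1g ≤ -(1 / 26 : ℝ) := by
  have wU1 := klb1gd_window_b1g_le klCertB1gWinU1 klCertB1gWinU1_check hU1 (1 / 26) klCertB1gWinU1_b1g_le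
  have wU2 := klb1gd_window_b1g_le klCertB1gWinU2 klCertB1gWinU2_check hU2 (1 / 26) klCertB1gWinU2_b1g_le
  have wU3 := klb1gd_window_b1g_le klCertB1gWinU3 klCertB1gWinU3_check hU3 (1 / 26) klCertB1gWinU3_b1g_le
  have wV := klb1gd_window_b1g_le klCertB1gWinV klCertB1gWinV_check hV (1 / 26) klCertB1gWinV_b1g_le
  have wW := klb1gd_window_b1g_le klCertB1gWinW klCertB1gWinW_check hW (1 / 26) klCertB1gWinW_b1g_le
  have ea : (((1 / 26 : ℚ) : ℚ) : ℝ) = (1 / 26 : ℝ) := by push_cast; norm_num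
  have loU1 : (((klCertB1gWinU1).mub : ℚ) : ℝ) = -0.8925 := by
    show ((((-357 : ℚ) / 400) : ℚ) : ℝ) = -0.8925
    push_cast; norm_num
  have hiU1 : (((klCertB1gWinU1).mua : ℚ) : ℝ) = -0.8625 := by
    show ((((-69 : ℚ) / 80) : ℚ) : ℝ) = -0.8625
    push_cast; norm_num
  rw [loU1, hiU1, ea] at wU1
  have loU2 : (((klCertB1gWinU2).mub : ℚ) : ℝ) = -0.8625 := by
    show ((((-69 : ℚ) / 80) : ℚ) : ℝ) = -0.8625
    push_cast; norm_num
  have hiU2 : (((klCertB1gWinU2).mua : ℚ) : ℝ) = -0.8325 := by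
    show ((((-333 : ℚ) / 400) : ℚ) : ℝ) = -0.8325
    push_cast; norm_num
  rw [loU2, hiU2, ea] at wU2
  have loU3 : (((klCertB1gWinU3).mub : ℚ) : ℝ) = -0.8325 := by
    show ((((-333 : ℚ) / 400) : ℚ) : ℝ) = -0.8325
    push_cast; norm_num
  have hiU3 : (((klCertB1gWinU3).mua : ℚ) : ℝ) = -0.8025 := by
    show ((((-321 : ℚ) / 400) : ℚ) : ℝ) = -0.8025
    push_cast; norm_num
  rw [loU3, hiU3, ea] at wU3
  have loV : (((klCertB1gWinV).mub : ℚ) : ℝ) = -0.8025 := by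
    show ((((-321 : ℚ) / 400) : ℚ) : ℝ) = -0.8025
    push_cast; norm_num
  have hiV : (((klCertB1gWinV).mua : ℚ) : ℝ) = -0.765 := by
    show ((((-153 : ℚ) / 200) : ℚ) : ℝ) = -0.765
    push_cast; norm_num
  rw [loV, hiV, ea] at wV
  have loW : (((klCertB1gWinW).mub : ℚ) : ℝ) = -0.765 := by
    show ((((-153 : ℚ) / 200) : ℚ) : ℝ) = -0.765
    push_cast; norm_num
  have hiW : (((klCertB1gWinW).mua : ℚ) : ℝ) = -0.7275 := by
    show ((((-291 : ℚ) / 400) : ℚ) : ℝ) = -0.7275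
    push_cast; norm_num
  rw [loW, hiW, ea] at wW
  intro μ hμ
  by_cases cU1 : μ ≤ -0.8625
  · exact wU1 μ ⟨hμ.1, cU1⟩
  · by_cases cU2 : μ ≤ -0.8325
    · exact wU2 μ ⟨by linarith, cU2⟩
    · by_cases cU3 : μ ≤ -0.8025
      · exact wU3 μ ⟨by linarith, cU3⟩
      · by_cases cV : μ ≤ -0.765
        · exact wV μ ⟨by linarith, cV⟩
        · exact wW μ ⟨by linarith, hμ.2⟩

/-! ### Selection at the μ level with the numeric margin `10371 / 1048576` -/

/-- **`B1g` dominance on `μ ∈ [-0.8925, -0.075]` with the numeric margin `10371 / 1048576`** (`= min` of the twelve record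
margins, `klb1g_window_d005_d035_gamma_eq`), modulo the twelve enclosure hypotheses. [cite: RaghuKivelsonScalapino2010, §III Fig. 2] -/
theorem klb1g_window_d005_d035_const (hU1 : klCertB1gWinU1.EnclosuresB1g) (hU2 : klCertB1gWinU2.EnclosuresB1g)
    (hU3 : klCertB1gWinU3.EnclosuresB1g) (hV : klCertB1gWinV.EnclosuresB1g) (hW : klCertB1gWinW.EnclosuresB1g)
    (hX : klCertB1gWinX.EnclosuresB1g) (hY : klCertB1gWinY.EnclosuresB1g)
    (hZ : klCertB1gWinZ.EnclosuresB1g) (hA : klCertB1gWinA.EnclosuresB1g) (hB : klCertB1gWinB.EnclosuresB1g)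
    (hC : klCertB1gWinC.EnclosuresB1g) (hD : klCertB1gWinD.EnclosuresB1g) :
    ∀ μ ∈ Set.Icc (-0.8925 : ℝ) (-0.075), ∀ U ∈ Set.Ioo (0 : ℝ) 1, ∀ χ : D4Irrep, χ ≠ D4Irrep.B1g →
      channelInf (squareDispersion 1 0) μ U D4Irrep.B1g + (10371 / 1048576 : ℝ) * U ^ 2 ≤
        channelInf (squareDispersion 1 0) μ U χ := by
  have h := klb1g_window_d005_d035 hU1 hU2 hU3 hV hW hX hY hZ hA hB hC hD
  have hγ : min (min ((klCertB1gWinU1.gamma : ℚ) : ℝ) (min ((klCertB1gWinU2.gamma : ℚ) : ℝ) (min ((klCertB1gWinU3.gamma : ℚ) : ℝ) (min ((klCertB1gWinV.gamma : ℚ) : ℝ) ((klCertB1gWinW.gamma : ℚ) : ℝ)))))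
      (min ((klCertB1gWinX.gamma : ℚ) : ℝ)
            (min ((klCertB1gWinY.gamma : ℚ) : ℝ)
              (min (min ((klCertB1gWinZ.gamma : ℚ) : ℝ)
                (min (min ((klCertB1gWinA.gamma : ℚ) : ℝ) ((klCertB1gWinB.gamma : ℚ) : ℝ)) ((klCertB1gWinC.gamma : ℚ) : ℝ)))
                ((klCertB1gWinD.gamma : ℚ) : ℝ)))) = (10371 / 1048576 : ℝ) := by
    have hq := congrArg (fun q : ℚ => (q : ℝ)) klb1g_window_d005_d035_gamma_eq
    push_cast at hq
    exact hq
  rw [hγ] at h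
  exact h

/-- **`B1g` dominance on `μ ∈ [-0.8925, -0.1775]` (⊃ `μ([0.10, 0.35])`) with the numeric margin `10371 / 1048576`, modulo the
ELEVEN enclosure hypotheses** (no `WinD`): union of the 5 stretch records (margins `≥ 10371 / 1048576`) and
`klb1g_window_d010_d030_const` (margin `14349/1048576 ≥ 10371 / 1048576` on `[-0.7275, -0.1775]`). [cite:
RaghuKivelsonScalapino2010, §III Fig. 2] -/
theorem klb1g_window_d010_d035_const (hU1 : klCertB1gWinU1.EnclosuresB1g) (hU2 : klCertB1gWinU2.EnclosuresB1g)
    (hU3 : klCertB1gWinU3.EnclosuresB1g) (hV : klCertB1gWinV.EnclosuresB1g) (hW : klCertB1gWinW.EnclosuresB1g)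
    (hX : klCertB1gWinX.EnclosuresB1g) (hY : klCertB1gWinY.EnclosuresB1g)
    (hZ : klCertB1gWinZ.EnclosuresB1g) (hA : klCertB1gWinA.EnclosuresB1g) (hB : klCertB1gWinB.EnclosuresB1g)
    (hC : klCertB1gWinC.EnclosuresB1g) :
    ∀ μ ∈ Set.Icc (-0.8925 : ℝ) (-0.1775), ∀ U ∈ Set.Ioo (0 : ℝ) 1, ∀ χ : D4Irrep, χ ≠ D4Irrep.B1g →
      channelInf (squareDispersion 1 0) μ U D4Irrep.B1g + (10371 / 1048576 : ℝ) * U ^ 2 ≤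
        channelInf (squareDispersion 1 0) μ U χ := by
  have wU1 := klCertB1gWinU1_window_U hU1
  have wU2 := klCertB1gWinU2_window_U hU2
  have wU3 := klCertB1gWinU3_window_U hU3
  have wV := klCertB1gWinV_window_U hV
  have wW := klCertB1gWinW_window_U hW
  have w30 := klb1g_window_d010_d030_const hX hY hZ hA hB hC
  have loU1 : (((klCertB1gWinU1).mub : ℚ) : ℝ) = -0.8925 := by
    show ((((-357 : ℚ) / 400) : ℚ) : ℝ) = -0.8925
    push_cast; norm_num
  have hiU1 : (((klCertB1gWinU1).mua : ℚ) : ℝ) = -0.8625 := by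
    show ((((-69 : ℚ) / 80) : ℚ) : ℝ) = -0.8625
    push_cast; norm_num
  rw [loU1, hiU1] at wU1
  have loU2 : (((klCertB1gWinU2).mub : ℚ) : ℝ) = -0.8625 := by
    show ((((-69 : ℚ) / 80) : ℚ) : ℝ) = -0.8625
    push_cast; norm_num
  have hiU2 : (((klCertB1gWinU2).mua : ℚ) : ℝ) = -0.8325 := by
    show ((((-333 : ℚ) / 400) : ℚ) : ℝ) = -0.8325
    push_cast; norm_num
  rw [loU2, hiU2] at wU2
  have loU3 : (((klCertB1gWinU3).mub : ℚ) : ℝ) = -0.8325 := by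
    show ((((-333 : ℚ) / 400) : ℚ) : ℝ) = -0.8325
    push_cast; norm_num
  have hiU3 : (((klCertB1gWinU3).mua : ℚ) : ℝ) = -0.8025 := by
    show ((((-321 : ℚ) / 400) : ℚ) : ℝ) = -0.8025
    push_cast; norm_num
  rw [loU3, hiU3] at wU3
  have loV : (((klCertB1gWinV).mub : ℚ) : ℝ) = -0.8025 := by
    show ((((-321 : ℚ) / 400) : ℚ) : ℝ) = -0.8025
    push_cast; norm_num
  have hiV : (((klCertB1gWinV).mua : ℚ) : ℝ) = -0.765 := by
    show ((((-153 : ℚ) / 200) : ℚ) : ℝ) = -0.765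
    push_cast; norm_num
  rw [loV, hiV] at wV
  have loW : (((klCertB1gWinW).mub : ℚ) : ℝ) = -0.765 := by
    show ((((-153 : ℚ) / 200) : ℚ) : ℝ) = -0.765
    push_cast; norm_num
  have hiW : (((klCertB1gWinW).mua : ℚ) : ℝ) = -0.7275 := by
    show ((((-291 : ℚ) / 400) : ℚ) : ℝ) = -0.7275
    push_cast; norm_num
  rw [loW, hiW] at wW
  have gU1 : (10371 / 1048576 : ℝ) ≤ ((klCertB1gWinU1.gamma : ℚ) : ℝ) := by
    have hq : (10371 / 1048576 : ℚ) ≤ klCertB1gWinU1.gamma := by decide +kernel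
    have h' : ((10371 / 1048576 : ℚ) : ℝ) ≤ ((klCertB1gWinU1.gamma : ℚ) : ℝ) := by exact_mod_cast hq
    push_cast at h'; exact h'
  have gU2 : (10371 / 1048576 : ℝ) ≤ ((klCertB1gWinU2.gamma : ℚ) : ℝ) := by
    have hq : (10371 / 1048576 : ℚ) ≤ klCertB1gWinU2.gamma := by decide +kernel
    have h' : ((10371 / 1048576 : ℚ) : ℝ) ≤ ((klCertB1gWinU2.gamma : ℚ) : ℝ) := by exact_mod_cast hq
    push_cast at h'; exact h'
  have gU3 : (10371 / 1048576 : ℝ) ≤ ((klCertB1gWinU3.gamma : ℚ) : ℝ) := by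
    have hq : (10371 / 1048576 : ℚ) ≤ klCertB1gWinU3.gamma := by decide +kernel
    have h' : ((10371 / 1048576 : ℚ) : ℝ) ≤ ((klCertB1gWinU3.gamma : ℚ) : ℝ) := by exact_mod_cast hq
    push_cast at h'; exact h'
  have gV : (10371 / 1048576 : ℝ) ≤ ((klCertB1gWinV.gamma : ℚ) : ℝ) := by
    have hq : (10371 / 1048576 : ℚ) ≤ klCertB1gWinV.gamma := by decide +kernel
    have h' : ((10371 / 1048576 : ℚ) : ℝ) ≤ ((klCertB1gWinV.gamma : ℚ) : ℝ) := by exact_mod_cast hq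
    push_cast at h'; exact h'
  have gW : (10371 / 1048576 : ℝ) ≤ ((klCertB1gWinW.gamma : ℚ) : ℝ) := by
    have hq : (10371 / 1048576 : ℚ) ≤ klCertB1gWinW.gamma := by decide +kernel
    have h' : ((10371 / 1048576 : ℚ) : ℝ) ≤ ((klCertB1gWinW.gamma : ℚ) : ℝ) := by exact_mod_cast hq
    push_cast at h'; exact h'
  intro μ hμ U hU χ hχ
  have hU2 : 0 ≤ U ^ 2 := sq_nonneg U
  by_cases cU1 : μ ≤ -0.8625
  · have h := wU1 μ ⟨hμ.1, cU1⟩ U hU χ hχ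
    nlinarith [gU1]
  · by_cases cU2 : μ ≤ -0.8325
    · have h := wU2 μ ⟨by linarith, cU2⟩ U hU χ hχ
      nlinarith [gU2]
    · by_cases cU3 : μ ≤ -0.8025
      · have h := wU3 μ ⟨by linarith, cU3⟩ U hU χ hχ
        nlinarith [gU3]
      · by_cases cV : μ ≤ -0.765
        · have h := wV μ ⟨by linarith, cV⟩ U hU χ hχ
          nlinarith [gV]
        · by_cases cW : μ ≤ -0.7275
          · have h := wW μ ⟨by linarith, cW⟩ U hU χ hχ
            nlinarith [gW]
          · have h := w30 μ ⟨by linarith, hμ.2⟩ U hU χ hχ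
            nlinarith

/-! ### The δ-form certificates -/

/-- **R2d certificate half — form (A), δ-form on the FULL window `δ ∈ [0.05, 0.35]`.** Modulo the certified enclosures of the
twelve window records: for every `δ ∈ [0.05, 0.35]`, with `μ(δ) = chemicalPotentialOfDensity ε₀ (1 - δ)`: (i) SELECTION — for
every `0 < U < 1` and every `χ ≠ B1g`, `channelInf ε₀ μ(δ) U B1g + (10371 / 1048576) U² ≤ channelInf ε₀ μ(δ) U χ`;
(ii) ATTRACTION — for every real `U`, `channelInf ε₀ μ(δ) U B1g ≤ -(1 / 26) U²`. [cite: RaghuKivelsonScalapino2010, §III Fig. 2] -/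
theorem klb1g_formA_r2d_certificate_d005_d035 (hU1 : klCertB1gWinU1.EnclosuresB1g) (hU2 : klCertB1gWinU2.EnclosuresB1g)
    (hU3 : klCertB1gWinU3.EnclosuresB1g) (hV : klCertB1gWinV.EnclosuresB1g) (hW : klCertB1gWinW.EnclosuresB1g)
    (hX : klCertB1gWinX.EnclosuresB1g) (hY : klCertB1gWinY.EnclosuresB1g)
    (hZ : klCertB1gWinZ.EnclosuresB1g) (hA : klCertB1gWinA.EnclosuresB1g) (hB : klCertB1gWinB.EnclosuresB1g)
    (hC : klCertB1gWinC.EnclosuresB1g) (hD : klCertB1gWinD.EnclosuresB1g) :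
    ∀ δ ∈ Set.Icc (0.05 : ℝ) 0.35,
      (∀ U ∈ Set.Ioo (0 : ℝ) 1, ∀ χ : D4Irrep, χ ≠ D4Irrep.B1g →
        channelInf (squareDispersion 1 0) (chemicalPotentialOfDensity (squareDispersion 1 0) (1 - δ)) U D4Irrep.B1g +
            (10371 / 1048576 : ℝ) * U ^ 2 ≤
          channelInf (squareDispersion 1 0) (chemicalPotentialOfDensity (squareDispersion 1 0) (1 - δ)) U χ) ∧
      (∀ U : ℝ, channelInf (squareDispersion 1 0) (chemicalPotentialOfDensity (squareDispersion 1 0) (1 - δ)) U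
          D4Irrep.B1g ≤ -(1 / 26 : ℝ) * U ^ 2) := by
  intro δ hδ
  have hμ := muOfDoping_mem_window_d005_d035 δ hδ
  set μ := chemicalPotentialOfDensity (squareDispersion 1 0) (1 - δ) with hμdef
  have hmo : μ ∈ Set.Ioo (-4 : ℝ) 0 := ⟨by linarith [hμ.1], by linarith [hμ.2]⟩
  refine ⟨fun U hU χ hχ => klb1g_window_d005_d035_const hU1 hU2 hU3 hV hW hX hY hZ hA hB hC hD μ hμ U hU χ hχ, fun U => ?_⟩
  have hfin : IsFiniteMeasure (fermiCurveMeasure (squareDispersion 1 0) μ) :=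
    stub_klFiniteMeasure stub_klGradient stub_klHausdorffFinite μ hmo
  have hinv := stub_klD4Invariant stub_klGradient μ hmo
  have hhom : channelInf (squareDispersion 1 0) μ U D4Irrep.B1g =
      U ^ 2 * channelInf (squareDispersion 1 0) μ 1 D4Irrep.B1g :=
    klhs_channelInf_sq stub_klKernelHS hmo U D4Irrep.B1g
      (fun ψ hψ => (stub_klMeanZero _ _ hfin hinv D4Irrep.B1g ψ (by decide) hψ).2)
  have h1 : channelInf (squareDispersion 1 0) μ 1 D4Irrep.B1g ≤ -(1 / 26 : ℝ) := by
    by_cases hs : μ ≤ -0.7275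
    · have := klb1g_formA_b1g_le_window_d030_d035 hU1 hU2 hU3 hV hW μ ⟨hμ.1, hs⟩
      linarith
    · by_cases hy : μ ≤ -0.5725
      · have := klb1g_formA_b1g_le_window_d025_d030 hX hY μ ⟨by linarith, hy⟩
        linarith
      · by_cases hz : μ ≤ -0.42749
        · have := klb1g_formA_b1g_le_window_d020_d025 hZ μ ⟨by linarith, hz⟩
          linarith
        · by_cases hd : μ ≤ -0.1775
          · have := klb1g_formA_b1g_le_window hA hB hC μ ⟨by linarith, hd⟩
            linarith
          · have := klb1g_formA_b1g_le_window_d005_d010 hD μ ⟨by linarith, hμ.2⟩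
            linarith
  rw [hhom]
  nlinarith [sq_nonneg U]

/-- **R2d certificate half — form (A), δ-form on `δ ∈ [0.10, 0.35]` = the leaf's FULL analysis window**, modulo the ELEVEN records
(no `WinD`): same selection margin `10371 / 1048576` and attraction constant `1 / 26`. [cite: RaghuKivelsonScalapino2010, §III Fig. 2] -/
theorem klb1g_formA_r2d_certificate_d010_d035 (hU1 : klCertB1gWinU1.EnclosuresB1g) (hU2 : klCertB1gWinU2.EnclosuresB1g)
    (hU3 : klCertB1gWinU3.EnclosuresB1g) (hV : klCertB1gWinV.EnclosuresB1g) (hW : klCertB1gWinW.EnclosuresB1g)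
    (hX : klCertB1gWinX.EnclosuresB1g) (hY : klCertB1gWinY.EnclosuresB1g)
    (hZ : klCertB1gWinZ.EnclosuresB1g) (hA : klCertB1gWinA.EnclosuresB1g) (hB : klCertB1gWinB.EnclosuresB1g)
    (hC : klCertB1gWinC.EnclosuresB1g) :
    ∀ δ ∈ Set.Icc (0.10 : ℝ) 0.35,
      (∀ U ∈ Set.Ioo (0 : ℝ) 1, ∀ χ : D4Irrep, χ ≠ D4Irrep.B1g →
        channelInf (squareDispersion 1 0) (chemicalPotentialOfDensity (squareDispersion 1 0) (1 - δ)) U D4Irrep.B1g +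
            (10371 / 1048576 : ℝ) * U ^ 2 ≤
          channelInf (squareDispersion 1 0) (chemicalPotentialOfDensity (squareDispersion 1 0) (1 - δ)) U χ) ∧
      (∀ U : ℝ, channelInf (squareDispersion 1 0) (chemicalPotentialOfDensity (squareDispersion 1 0) (1 - δ)) U
          D4Irrep.B1g ≤ -(1 / 26 : ℝ) * U ^ 2) := by
  intro δ hδ
  have hμ := muOfDoping_mem_window_d010_d035 δ hδ
  set μ := chemicalPotentialOfDensity (squareDispersion 1 0) (1 - δ) with hμdef
  have hmo : μ ∈ Set.Ioo (-4 : ℝ) 0 := ⟨by linarith [hμ.1], by linarith [hμ.2]⟩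
  refine ⟨fun U hU χ hχ => klb1g_window_d010_d035_const hU1 hU2 hU3 hV hW hX hY hZ hA hB hC μ hμ U hU χ hχ, fun U => ?_⟩
  have hfin : IsFiniteMeasure (fermiCurveMeasure (squareDispersion 1 0) μ) :=
    stub_klFiniteMeasure stub_klGradient stub_klHausdorffFinite μ hmo
  have hinv := stub_klD4Invariant stub_klGradient μ hmo
  have hhom : channelInf (squareDispersion 1 0) μ U D4Irrep.B1g =
      U ^ 2 * channelInf (squareDispersion 1 0) μ 1 D4Irrep.B1g :=
    klhs_channelInf_sq stub_klKernelHS hmo U D4Irrep.B1g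
      (fun ψ hψ => (stub_klMeanZero _ _ hfin hinv D4Irrep.B1g ψ (by decide) hψ).2)
  have h1 : channelInf (squareDispersion 1 0) μ 1 D4Irrep.B1g ≤ -(1 / 26 : ℝ) := by
    by_cases hs : μ ≤ -0.7275
    · have := klb1g_formA_b1g_le_window_d030_d035 hU1 hU2 hU3 hV hW μ ⟨hμ.1, hs⟩
      linarith
    · by_cases hy : μ ≤ -0.5725
      · have := klb1g_formA_b1g_le_window_d025_d030 hX hY μ ⟨by linarith, hy⟩
        linarith
      · by_cases hz : μ ≤ -0.42749
        · have := klb1g_formA_b1g_le_window_d020_d025 hZ μ ⟨by linarith, hz⟩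
          linarith
        · have := klb1g_formA_b1g_le_window hA hB hC μ ⟨by linarith, hμ.2⟩
          linarith
  rw [hhom]
  nlinarith [sq_nonneg U]

/-- **Positivity of the Kohn–Luttinger coefficient on the full window `δ ∈ [0.05, 0.35]`, form (A)**: for every such `δ`,
`1 / 26 ≤ -channelInf ε₀ μ(δ) 1 B1g`. [cite: RaghuKivelsonScalapino2010, §III Fig. 2] -/
theorem klb1g_formA_klCoefficient_ge_d005_d035 (hU1 : klCertB1gWinU1.EnclosuresB1g) (hU2 : klCertB1gWinU2.EnclosuresB1g)
    (hU3 : klCertB1gWinU3.EnclosuresB1g) (hV : klCertB1gWinV.EnclosuresB1g) (hW : klCertB1gWinW.EnclosuresB1g)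
    (hX : klCertB1gWinX.EnclosuresB1g) (hY : klCertB1gWinY.EnclosuresB1g)
    (hZ : klCertB1gWinZ.EnclosuresB1g) (hA : klCertB1gWinA.EnclosuresB1g) (hB : klCertB1gWinB.EnclosuresB1g)
    (hC : klCertB1gWinC.EnclosuresB1g) (hD : klCertB1gWinD.EnclosuresB1g) :
    ∀ δ ∈ Set.Icc (0.05 : ℝ) 0.35,
      (1 / 26 : ℝ) ≤ -channelInf (squareDispersion 1 0) (chemicalPotentialOfDensity (squareDispersion 1 0) (1 - δ)) 1
        D4Irrep.B1g := by
  intro δ hδ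
  have h := (klb1g_formA_r2d_certificate_d005_d035 hU1 hU2 hU3 hV hW hX hY hZ hA hB hC hD δ hδ).2 1
  norm_num at h ⊢
  linarith

/-- **Positivity of the Kohn–Luttinger coefficient on `δ ∈ [0.10, 0.35]`, form (A)** (eleven records): for every such `δ`,
`1 / 26 ≤ -channelInf ε₀ μ(δ) 1 B1g`. [cite: RaghuKivelsonScalapino2010, §III Fig. 2] -/
theorem klb1g_formA_klCoefficient_ge_d010_d035 (hU1 : klCertB1gWinU1.EnclosuresB1g) (hU2 : klCertB1gWinU2.EnclosuresB1g)
    (hU3 : klCertB1gWinU3.EnclosuresB1g) (hV : klCertB1gWinV.EnclosuresB1g) (hW : klCertB1gWinW.EnclosuresB1g)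
    (hX : klCertB1gWinX.EnclosuresB1g) (hY : klCertB1gWinY.EnclosuresB1g)
    (hZ : klCertB1gWinZ.EnclosuresB1g) (hA : klCertB1gWinA.EnclosuresB1g) (hB : klCertB1gWinB.EnclosuresB1g)
    (hC : klCertB1gWinC.EnclosuresB1g) :
    ∀ δ ∈ Set.Icc (0.10 : ℝ) 0.35,
      (1 / 26 : ℝ) ≤ -channelInf (squareDispersion 1 0) (chemicalPotentialOfDensity (squareDispersion 1 0) (1 - δ)) 1
        D4Irrep.B1g := by
  intro δ hδ
  have h := (klb1g_formA_r2d_certificate_d010_d035 hU1 hU2 hU3 hV hW hX hY hZ hA hB hC δ hδ).2 1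
  norm_num at h ⊢
  linarith

end Summit.HubbardSuperconductivity.HubbardSuperconductivity.Theorems

end
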